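import Summits.ABC.ABC.Theses.DefiniteXi
import Literature.NumberTheory.EllipticCurves.TakahashiDegreeFormulaFromDictionaryHolds
import HarnessLib

/-!
# Crux `EisensteinQuarantine` (stmt-ABC-15023), line `forced-pair-dlog`: the registered stub
# `stub_brandtEigenLatticeRankOne` — and the route item `BrandtEigenLatticeRankOne` (stmt-ABC-17203)

Support file for the crux `Summit.ABC.ABC.Theses.DefiniteXi.EisensteinQuarantine`, line
`forced-pair-dlog` (skeleton `Cruxes/EisensteinQuarantine/Lines/forced_pair_dlog.lean`, rev 5),
registered stub `stub_brandtEigenLatticeRankOne : DefiniteXi.BrandtEigenLatticeRankOne`.  The stub is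
the route item `DefiniteXi.BrandtEigenLatticeRankOne` (crux r8, stmt-ABC-17203), whose body is VERBATIM
the named fact `Literature.NumberTheory.EllipticCurves.takahashi2001_brandtEigenLattice_rank_one`
(Takahashi 2001 §2 p. 78: for `W/ℚ` elliptic of squarefree conductor `M r`, `r` prime, carrying a
modular parametrisation datum at level `M r`, and every Brandt setup of type `(M, r)`, the
`a(W)`-eigen-lattice of the Brandt matrices has `ℤ`-rank one; = Eichler's basis problem, Pizer 1980
Thm 2.28, + Atkin–Lehner multiplicity one + Hasse).  That fact is DISCHARGED in the tree:
`takahashi2001_brandtEigenLattice_rank_one_holds` (`TakahashiDegreeFormulaFromDictionaryHolds.lean`)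
composes the reduction `takahashi2001_brandtEigenLattice_rank_one_of_cuspidalHeckeTrace_eq`
(Eichler's Brandt trace formula, the mass formula and Pizer's trace identity (2.8) proved inside)
with the squarefree weight-2 Eichler–Selberg identities `ModularForms.cuspidalHeckeTrace_eq_geometricSide`
(Popa–Zagier).  So both theorems below are that theorem, by definitional unfolding
(`brandtEigenLatticeRankOne_iff_takahashi2001 = Iff.rfl`, `DefiniteXiEisensteinQuarantineFreyEigenLinePrime.lean`).
Nothing is defined; no unproved named fact is used.

## References

* [Takahashi2001] S. Takahashi, J. Number Theory 90 (2001), 74–88, §2 p. 78.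
* [Pizer1980] A. Pizer, J. Algebra 64 (1980), 340–390, Thm. 2.25 (2.8), Thm. 2.28.
-/

namespace Summit.ABC.ABC.Theorems

/-- **Route item `DefiniteXi.BrandtEigenLatticeRankOne` (crux r8, stmt-ABC-17203) holds**: its body is
verbatim the named fact `takahashi2001_brandtEigenLattice_rank_one`, proved in the tree
(`takahashi2001_brandtEigenLattice_rank_one_holds`).
[cite: Takahashi2001, §2 p. 78] [cite: Pizer1980, Thm. 2.28] -/
theorem brandtEigenLatticeRankOne_holds :
    Summit.ABC.ABC.Theses.DefiniteXi.BrandtEigenLatticeRankOne :=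
  Literature.NumberTheory.EllipticCurves.takahashi2001_brandtEigenLattice_rank_one_holds

/-- **Registered stub `stub_brandtEigenLatticeRankOne`** (crux `EisensteinQuarantine`, line
`forced-pair-dlog`, rev 5), verbatim name and signature. [cite: Takahashi2001, §2 p. 78] -/
theorem stub_brandtEigenLatticeRankOne :
    Summit.ABC.ABC.Theses.DefiniteXi.BrandtEigenLatticeRankOne :=
  brandtEigenLatticeRankOne_holds

end Summit.ABC.ABC.Theorems
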